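import Literature.MathematicalPhysics.QuantumLattice.InfVolFermionStateProduct
import Literature.MathematicalPhysics.QuantumLattice.HubbardHoppingFamilyLatticeSymmetry
import Literature.MathematicalPhysics.QuantumLattice.TranslationInvariantFermionStatesAreEven
import HarnessLib

/-!
# Layered crystals: stacking a translation-invariant state into `ℤ^{d+1}` and the dimension-raising
# transport of certified one-band windows (`e_ρ(ℤ^d) − 2Σ|t_z| ≤ e_ρ(layered ℤ^{d+1}) ≤ e_ρ(ℤ^d)`)

Topic `Literature/MathematicalPhysics/QuantumLattice` (namespace = path; family `hubbard`). Sequel of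
`InfVolFermionStateProduct.lean` (Araki–Moriya's product state of even states over a tiling). Written for
stage S2 («families of models», «interlayer coupling») of the Hubbard material-oracle programme: the
materials are three-dimensional LAYERED crystals, the certified numbers of record are for the
two-dimensional one-band `t–t'–U` model. This file makes every certified 2D fixed-filling window a word
for the 3D one-band crystal Hamiltonian with arbitrary interlayer hoppings:

* CAP (`tiGroundEnergyDensityAt_layeredModel_le`): the STACK `⊗_{k ∈ ℤ} ω₀` of a translation-invariant
  state `ω₀` of `ℤ^d` is a translation-invariant state of `ℤ^{d+1}` of the same density whose mean
  energy for the layered model equals `e(ω₀)` for the one-band model — in-plane bonds see `ω₀` (layer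
  marginal = `ω₀`, pullback of bond energies), on-site terms see `ω₀`, and INTERLAYER BONDS SEE NOTHING
  (`ω̃(c†_x c_{x'}) = 0` across layers: odd ⊗ odd in a product of even states);
* FLOOR (`tiGroundEnergyDensityAt_sub_le_layeredModel`): every translation-invariant state of `ℤ^{d+1}`
  restricts (pullback along the layer inclusion) to a translation-invariant state of `ℤ^d` with the same
  density, and the interlayer bond energies are `≥ −2|tz_b|` each (norm row).

## Contents

* §1 layers: `layerTiling d : ℤ × Site d ≃ Site (d+1)` (`Fin.consEquiv`; layer index = coordinate `0`),
  `layerHom d : Site d →+ Site (d+1)` (`y ↦ (0, y)`), how translations act on layers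
  (`tileLeg_layerTiling_add`), range boxes (`layerHom_mem_thicken`).
* §2 models: `vectorHoppingModel U u θ = Φ^{0,U} + Σ_a θ_a Φ_{u_a}` (any bond vectors; mean energy
  `e_{Φ^{0,U}}(ω) + Σ_a θ_a K_{u_a}(ω)`), `layeredModel U u θ w tz` on `ℤ^{d+1}` (in-plane lifts + interlayer
  vectors `w_b`), `meanEnergy_layeredModel`.
* §3 `InfVolFermionState.stack ω₀ h` (= `productState (layerTiling d) (fun _ => ω₀)`): translation invariant
  for translation-invariant `ω₀`, layer marginal `mapAct (layerHom d) (stack ω₀) = ω₀`, densities.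
* §4 energies of the stack: `meanEnergy_stack_vectorHopping_layerHom` (in-plane `= K_u(ω₀)`),
  `meanEnergy_stack_onSite`, **`stack_expect_creation_mul_annihilation_eq_zero`** (interlayer words vanish),
  `meanEnergy_stack_vectorHopping_eq_zero`, **`meanEnergy_stack_layeredModel`** (`= e(ω₀)`).
* §5 transport: `IsTranslationInvariant.meanEnergy_layeredModel_eq_mapAct_add` (pullback decomposition),
  **`tiGroundEnergyDensityAt_layeredModel_le`** (cap), **`tiGroundEnergyDensityAt_sub_le_layeredModel`**
  (floor), `…_mem_Icc`, `…_mem_Icc_of_window`.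
* §6 the `t–t'` layer (`d = 2 → 3`): `ttPrimeVec`/`ttPrimeAmp`, the dictionary
  `hubbardTTPrimeFermionInteraction_eq_vectorHoppingModel`, `layeredHubbardTTPrime t t' U w tz`, and
  **`tiGroundEnergyDensityAt_layeredHubbardTTPrime_mem_Icc`**:
  `e_ρ(layered) ∈ [energyDensityTT' t t' U ρ − 2Σ|tz_b|, energyDensityTT' t t' U ρ]` (`U ≥ 0`, `0 < ρ < 2`),
  window form, and the simple-tetragonal instance (`…_verticalHubbardTTPrime_mem_Icc`: allowance `2|t_z|`).
* §7 the nearest-neighbour model in any `d ≥ 1` (`tiGroundEnergyDensityAt_layeredHubbard_mem_Icc`: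
  chains ⇒ coupled-chain arrays, square ⇒ cubic layered, …).
* §8 (append) ENERGY-WINDOW WORDS TRANSFER: the layer marginal of a near-ground state of the crystal is a
  near-ground state of the one-band model with slack `+ 2Σ|tz_b|`
  (`IsTranslationInvariant.meanEnergy_mapAct_layerHom_le_of_le`), hence every word certified for 2D
  near-minimisers holds for it (`layeredModel_energyWindow_word_mapAct_layerHom`,
  `layeredHubbardTTPrime_energyWindow_word_mapAct_layerHom`).
* §9 (append) BOX WORDS in S2-seam shape: `layeredHubbardTTPrime_boxword_of_boxword` (a 2D box word
  `∀ θ ∈ B, lo ≤ energyDensityTT' 1 (θ 1) (θ 0) (θ 2) ≤ hi` is the crystal word `[lo − 2Σ|tz_b|, hi]` on `B`),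
  `…_of_sum_le` (interlayer amplitude box `Σ|tz_b| ≤ m`), `layeredHubbardTTPrime_boxword_Icc`.

Everything is PROVED; definitions with bodies: `layerTiling`, `layerHom`, `vectorHoppingModel`, `layeredModel`,
`InfVolFermionState.stack`, `ttPrimeVec`, `ttPrimeAmp`, `layeredHubbardTTPrime`. No named fact, no number.
NUMBERS FOR ORIENTATION ONLY [float, screening-grade router values]: La₂₋ₓSrₓCuO₄ `t_z/t ≈ 0.03–0.07` ⇒ floor
allowance `0.06–0.14 t`; the Hg-1223 router rows give `tperp/t ∈ [0.05, 0.19]` ⇒ `0.1–0.4 t`. HONEST SCOPE: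
ground-state energy densities at fixed filling only (no order parameter, no `T > 0`, no phase word); the
interlayer constant is the NORM row `2` per bond vector (a kinematic single-direction row would give `4/π`;
not in the tree); the cap is exact at `tz = 0` but carries no `tz`-improvement (concavity in `tz` with slope
`0` at the stack is the statement); the base filling must be realised on `ℤ^d` (`0 < ρ < 2` on `ℤ²`).

## Tree / Mathlib search

REUSED: `productState` + `productState_mapAct/_isTranslationInvariant/_expect_fermionEmbed_mul_fermionEmbed_of_odd`,
`densityAt_productState` (`InfVolFermionStateProduct`); `vectorHoppingFermionInteraction` + `_apply_pair`,
`_meanEnergyObs`, `abs_meanEnergy_vectorHopping_le`, `meanEnergy_vectorHopping_mapAct`,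
`hubbardFermionInteraction_apply_eq_onSite_add_sum_vectorHopping`, `diagHoppingFermionInteraction_apply_eq_sum_vectorHopping`,
`hubbardFermionInteraction_eq_linearFamily_vectorHopping` (`LatticeVectorHoppingInteraction`);
`IsTranslationInvariant.meanEnergy_onSite_mapAct` (`HubbardHoppingFamilyLatticeSymmetry`); `linearFamily`,
`meanEnergy_linearFamily`, `tiGroundEnergyDensityAt` + `le_…`/`…_le_meanEnergy`,
`tiGroundEnergyDensityAt_hubbardTTPrime_eq_energyDensityTT'`, `exists_isTranslationInvariant_density_eq`
(`TIGroundEnergyDensityCouplingFamilies`); `IsTranslationInvariant.mapAct`, `density_mapAct`, `mem_thicken_zero_iff`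
(`InfVolFermionStateLatticeMapPullback`); `IsTranslationInvariant.isEven`; Mathlib `Fin.consEquiv`, `Fin.cons_self_tail`.
`lean search 'stack|layered|interlayer.*InfVolFermionState'`: only `HubbardBilayerByDecoration` (a bilayer drawn
inside `ℤ²`, floor side only) — no `ℤ^{d+1}` layering.

## References

* H. Araki, H. Moriya, Rev. Math. Phys. 15 (2003) 93, §11.1 Theorem 11.2 (product states of even states),
  §4.1 (translations, even states). [cite: ArakiMoriya2003, §11.1 Theorem 11.2]
* O. Bratteli, A. Kishimoto, D. W. Robinson, CMP 64 (1978) 41, §3 and Thm. 2 (mean energy; invariant ground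
  states as minimisers). [cite: BratteliKishimotoRobinson1978, Thm. 2]
* O. Bratteli, D. W. Robinson, *OAQSM 1* (1987), §4.3.1 (states composed with morphisms of the quasi-local
  algebra). [cite: BratteliRobinsonI1987, §4.3.1]
* E. Pavarini, I. Dasgupta, T. Saha-Dasgupta, O. Jepsen, O. K. Andersen, PRL 87 (2001) 047003, eq. (1)
  (one-band models of layered cuprates: in-plane `t, t', t''` and interlayer hoppings). [cite: PavariniEtAl2001, eq. (1)]
-/

noncomputable section

namespace Literature.MathematicalPhysics.QuantumLattice

open Matrix Finset HubbardWave0 Literature.Probability.LatticeModels ThermodynamicLimit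
open scoped ComplexOrder BigOperators

/-! ### §1. Layers: `ℤ^{d+1} = ℤ × ℤ^d` (layer index = the most significant coordinate) -/

section Layers

variable {d : ℕ}

/-- **The layer tiling** `ℤ × ℤ^d ≃ ℤ^{d+1}`, `(k, y) ↦ (k, y₁, …, y_d)`: tile `k` = the layer
`{x : x₀ = k}`, local coordinates = the remaining `d` coordinates. [cite: ArakiMoriya2003, §11.1 (disjoint regions)] -/
def layerTiling (d : ℕ) : ℤ × Site d ≃ Site (d + 1) := Fin.consEquiv fun _ => ℤ

/-- The legs of the layer tiling are `y ↦ Fin.cons k y`. [cite: ArakiMoriya2003, §11.1] -/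
theorem tileLeg_layerTiling (k : ℤ) (y : Site d) : tileLeg (layerTiling d) k y = Fin.cons k y := rfl

/-- The class (layer index) of a site is its `0`-th coordinate. [cite: ArakiMoriya2003, §11.1] -/
theorem tileClass_layerTiling (x : Site (d + 1)) : tileClass (layerTiling d) x = x 0 := rfl

/-- The local coordinate of a site is its tail. [cite: ArakiMoriya2003, §11.1] -/
theorem tileCoord_layerTiling (x : Site (d + 1)) : tileCoord (layerTiling d) x = Fin.tail x := rfl

/-- Componentwise addition of `Fin.cons` vectors. [folklore] -/
private theorem cons_add_cons (a b : ℤ) (f g : Site d) :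
    (Fin.cons a f : Site (d + 1)) + Fin.cons b g = Fin.cons (a + b) (f + g) := by
  funext i
  refine Fin.cases ?_ (fun j => ?_) i
  · simp only [Pi.add_apply, Fin.cons_zero]
  · simp only [Pi.add_apply, Fin.cons_succ]

/-- `Fin.cons 0 0 = 0`. [folklore] -/
private theorem cons_zero_zero : (Fin.cons 0 0 : Site (d + 1)) = 0 := by
  funext i
  refine Fin.cases ?_ (fun j => ?_) i
  · simp only [Fin.cons_zero, Pi.zero_apply]
  · simp only [Fin.cons_succ, Pi.zero_apply]

/-- **The layer inclusion** `ℤ^d → ℤ^{d+1}`, `y ↦ (0, y)` (additive, injective): the `0`-th leg of the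
layer tiling as a group homomorphism. [cite: ArakiMoriya2003, §4.1] -/
def layerHom (d : ℕ) : Site d →+ Site (d + 1) where
  toFun y := Fin.cons 0 y
  map_zero' := cons_zero_zero
  map_add' y y' := by rw [cons_add_cons, add_zero]

/-- Unfolding the layer inclusion. [cite: ArakiMoriya2003, §4.1] -/
theorem layerHom_apply (y : Site d) : layerHom d y = Fin.cons 0 y := rfl

/-- The layer inclusion is the `0`-th leg. [cite: ArakiMoriya2003, §4.1] -/
theorem tileLeg_layerTiling_zero : tileLeg (layerTiling d) 0 = layerHom d := rfl

/-- The layer inclusion is injective. [cite: ArakiMoriya2003, §4.1] -/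
theorem layerHom_injective (d : ℕ) : Function.Injective (layerHom d) := tileLeg_injective (layerTiling d) 0

/-- A nonzero in-plane vector lifts to a nonzero vector. [cite: ArakiMoriya2003, §4.1] -/
theorem layerHom_ne_zero {u : Site d} (hu : u ≠ 0) : layerHom d u ≠ 0 := fun h =>
  hu (layerHom_injective d (by rw [h, map_zero]))

/-- The lift of an in-plane vector stays in the same range box. [cite: ArakiMoriya2003, §4.1] -/
theorem layerHom_mem_thicken {R : ℝ} {u : Site d} (hu : u ∈ thicken ({0} : Finset (Site d)) R) :
    layerHom d u ∈ thicken ({0} : Finset (Site (d + 1))) R := by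
  rw [mem_thicken_zero_iff] at hu ⊢
  intro i
  refine Fin.cases ?_ (fun j => ?_) i
  · rw [layerHom_apply, Fin.cons_zero]
    exact ⟨by simp, by simp⟩
  · rw [layerHom_apply, Fin.cons_succ]
    exact hu j

/-- **How lattice translations act on the layers**: `τ_v` maps layer `k` onto layer `k + v₀`, acting
as the in-plane translation by the tail of `v`. [cite: ArakiMoriya2003, §4.1 Def. 4.3] -/
theorem tileLeg_layerTiling_add (v : Site (d + 1)) (k : ℤ) (y : Site d) :
    tileLeg (layerTiling d) k y + v = tileLeg (layerTiling d) (k + v 0) (y + Fin.tail v) := by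
  rw [tileLeg_layerTiling, tileLeg_layerTiling]
  conv_lhs => rw [← Fin.cons_self_tail v]
  exact cons_add_cons k (v 0) y (Fin.tail v)

/-- Sites in different layers. [cite: ArakiMoriya2003, §11.1] -/
theorem apply_zero_ne_of_add {x w : Site (d + 1)} (hw : w 0 ≠ 0) : x 0 ≠ (x + w) 0 := by
  rw [Pi.add_apply]; intro h; exact hw (by linarith)

end Layers

/-! ### §2. One-band models with independent hopping vectors; layered models -/

section Models

variable {d : ℕ} {ι κ : Type*} [Fintype ι] [Fintype κ]

/-- **The one-band model with on-site repulsion `U` and hoppings `θ_a` along the vectors `u_a`**: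
`Φ^{0,U} + Σ_a θ_a Φ_{u_a}` (a linear family; every downfolded one-band tight-binding + Hubbard-`U`
Hamiltonian, one amplitude per bond vector). [cite: PavariniEtAl2001, eq. (1)] -/
def vectorHoppingModel (U : ℝ) (u : ι → Site d) (θ : ι → ℝ) : FermionInteraction d :=
  FermionInteraction.linearFamily (hubbardFermionInteraction d 0 U)
    (fun a => vectorHoppingFermionInteraction d (u a) 1) θ

/-- The model is an even interaction. [cite: ArakiMoriya2003, §1 assumption (II)] -/
theorem vectorHoppingModel_isEven (U : ℝ) (u : ι → Site d) (θ : ι → ℝ) : (vectorHoppingModel U u θ).IsEven :=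
  FermionInteraction.isEven_linearFamily (hubbardFermionInteraction_isEven 0 U)
    (fun a => vectorHoppingFermionInteraction_isEven (u a) 1) θ

/-- **Mean energy of the one-band model**: `e(ω) = e_{Φ^{0,U}}(ω) + Σ_a θ_a K_{u_a}(ω)` for every state
(`K_v(ω)` the `v`-bond energy per site). [cite: BratteliKishimotoRobinson1978, §3] -/
theorem InfVolFermionState.meanEnergy_vectorHoppingModel (ω : InfVolFermionState d) (U : ℝ) (u : ι → Site d)
    (θ : ι → ℝ) (R : ℝ) :
    ω.meanEnergy (vectorHoppingModel U u θ) R =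
      ω.meanEnergy (hubbardFermionInteraction d 0 U) R +
        ∑ a, θ a * ω.meanEnergy (vectorHoppingFermionInteraction d (u a) 1) R :=
  ω.meanEnergy_linearFamily _ _ θ R

/-- **The layered model on `ℤ^{d+1}`**: in every layer a copy of the one-band model (`U`, hoppings
`θ_a` along the lifted vectors `(0, u_a)`), plus INTERLAYER hoppings `tz_b` along vectors `w_b` (with
`(w_b)₀ ≠ 0` in the applications: vertical `(1, 0)`, staggered `(1, s)`, longer-range `(2, s)`, …).
The one-band Hamiltonian of a layered crystal. [cite: PavariniEtAl2001, eq. (1)] -/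
def layeredModel (U : ℝ) (u : ι → Site d) (θ : ι → ℝ) (w : κ → Site (d + 1)) (tz : κ → ℝ) :
    FermionInteraction (d + 1) :=
  vectorHoppingModel U (Sum.elim (fun a => layerHom d (u a)) w) (Sum.elim θ tz)

/-- **Mean energy of the layered model**: on-site part + in-plane bond energies + interlayer bond
energies. [cite: BratteliKishimotoRobinson1978, §3] -/
theorem InfVolFermionState.meanEnergy_layeredModel (ω : InfVolFermionState (d + 1)) (U : ℝ) (u : ι → Site d)
    (θ : ι → ℝ) (w : κ → Site (d + 1)) (tz : κ → ℝ) (R : ℝ) :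
    ω.meanEnergy (layeredModel U u θ w tz) R =
      ω.meanEnergy (hubbardFermionInteraction (d + 1) 0 U) R +
        ∑ a, θ a * ω.meanEnergy (vectorHoppingFermionInteraction (d + 1) (layerHom d (u a)) 1) R +
        ∑ b, tz b * ω.meanEnergy (vectorHoppingFermionInteraction (d + 1) (w b) 1) R := by
  rw [layeredModel, InfVolFermionState.meanEnergy_vectorHoppingModel, Fintype.sum_sum_type, add_assoc]
  rfl

end Models

/-! ### §3. The stacked state `⊗_{k ∈ ℤ} ω₀` -/

namespace InfVolFermionState

variable {d : ℕ}

/-- **The stack of an even state** `ω₀` of the lattice fermions on `ℤ^d`: the product state on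
`ℤ^{d+1}` with a copy of `ω₀` in every layer (Araki–Moriya's product state for the layer tiling).
[cite: ArakiMoriya2003, §11.1 Theorem 11.2] -/
def stack (ω₀ : InfVolFermionState d) (h : ω₀.IsEven) : InfVolFermionState (d + 1) :=
  productState (layerTiling d) (fun _ => ω₀) fun _ => h

/-- **The stack of a translation-invariant state is translation invariant** (a translation of
`ℤ^{d+1}` permutes the layers and translates within them). [cite: ArakiMoriya2003, §4.1 Def. 4.5] -/
theorem stack_isTranslationInvariant {ω₀ : InfVolFermionState d} (hω₀ : ω₀.IsTranslationInvariant)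
    (h : ω₀.IsEven) : (ω₀.stack h).IsTranslationInvariant :=
  productState_isTranslationInvariant (layerTiling d) (fun _ => ω₀) (fun _ => h) (fun v k => k + v 0)
    (fun _ _ _ hkj => add_right_cancel hkj) (fun v _ => Fin.tail v) (fun v k y => tileLeg_layerTiling_add v k y)
    fun v _ => hω₀ (Fin.tail v)

/-- **The layer marginal of the stack is `ω₀`**: `(⊗ ω₀) ∘ Γ_{layer} = ω₀`. [cite: ArakiMoriya2003, §11.1 Theorem 11.2] -/
theorem mapAct_layerHom_stack (ω₀ : InfVolFermionState d) (h : ω₀.IsEven) :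
    (ω₀.stack h).mapAct (layerHom d) (layerHom_injective d) = ω₀ :=
  productState_mapAct (layerTiling d) (fun _ => ω₀) (fun _ => h) 0

/-- Densities of the stack. [cite: ArakiMoriya2003, §11.1 Theorem 11.2] -/
theorem densityAt_stack (ω₀ : InfVolFermionState d) (h : ω₀.IsEven) (k : ℤ) (y : Site d) :
    (ω₀.stack h).densityAt (Fin.cons k y) = ω₀.densityAt y :=
  densityAt_productState (layerTiling d) (fun _ => ω₀) (fun _ => h) k y

/-- **The stack has the density of `ω₀`.** [cite: ArakiMoriya2003, §11.1 Theorem 11.2] -/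
theorem density_stack (ω₀ : InfVolFermionState d) (h : ω₀.IsEven) : (ω₀.stack h).density = ω₀.density := by
  rw [density, density, ← densityAt_stack ω₀ h 0 0]
  exact congrArg _ cons_zero_zero.symm

/-! ### §4. Energies of the stack: in-plane bonds see `ω₀`, interlayer bonds see nothing -/

/-- **In-plane bond energies of the stack are those of `ω₀`**: `K_{(0,u)}(⊗ ω₀) = K_u(ω₀)`.
[cite: BratteliRobinsonI1987, §4.3.1] -/
theorem meanEnergy_stack_vectorHopping_layerHom (ω₀ : InfVolFermionState d) (h : ω₀.IsEven) {u : Site d}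
    (hu : u ≠ 0) (t : ℝ) {R R' : ℝ} (huR : u ∈ thicken ({0} : Finset (Site d)) R)
    (huR' : layerHom d u ∈ thicken ({0} : Finset (Site (d + 1))) R') :
    (ω₀.stack h).meanEnergy (vectorHoppingFermionInteraction (d + 1) (layerHom d u) t) R' =
      ω₀.meanEnergy (vectorHoppingFermionInteraction d u t) R := by
  have h1 := (ω₀.stack h).meanEnergy_vectorHopping_mapAct (layerHom d) (layerHom_injective d) hu t huR huR'
  rw [mapAct_layerHom_stack] at h1
  exact h1.symm

/-- **The on-site energy of the stack is that of `ω₀`** (translation-invariant `ω₀`; range parameters `≥ 1`).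
[cite: BratteliRobinsonI1987, §4.3.1] -/
theorem meanEnergy_stack_onSite {ω₀ : InfVolFermionState d} (hω₀ : ω₀.IsTranslationInvariant) (h : ω₀.IsEven)
    (U : ℝ) {R R' : ℝ} (hR : 1 ≤ R) (hR' : 1 ≤ R') :
    (ω₀.stack h).meanEnergy (hubbardFermionInteraction (d + 1) 0 U) R' =
      ω₀.meanEnergy (hubbardFermionInteraction d 0 U) R := by
  have h1 := (stack_isTranslationInvariant hω₀ h).meanEnergy_onSite_mapAct (layerHom d) (layerHom_injective d) U hR hR'
  rw [mapAct_layerHom_stack] at h1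
  exact h1.symm

/-- A generator of `𝔄_Λ` at the site `x` is the leg-embedded generator of the layer of `x` at its local
coordinate. [cite: ArakiMoriya2003, §4.1 Def. 4.1 (2)] -/
theorem cAt_eq_fermionEmbed_tileEmb_layer {Λ : Finset (Site (d + 1))} (x : Site (d + 1)) (hx : x ∈ Λ) (σ : Fin 2) :
    cAt x hx σ = fermionEmbed (PolySite.tileEmb (layerTiling d) Λ (x 0))
      (cAt (Fin.tail x) ((mem_tileLoc (layerTiling d)).2 (by rw [tileLeg_layerTiling, Fin.cons_self_tail]; exact hx)) σ) := by
  symm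
  refine fermionEmbed_cAt_of_apply_eq _ _ hx (Subtype.ext ?_) σ
  rw [PolySite.tileEmb_pt]
  show toLex (tileLeg (layerTiling d) (x 0) (Fin.tail x)) = toLex x
  rw [tileLeg_layerTiling, Fin.cons_self_tail]

/-- **A hopping word between different layers has zero expectation in the stack** (odd ⊗ odd).
[cite: ArakiMoriya2003, §4.1 eq. (4.8) and §11.1 Theorem 11.2] -/
theorem stack_expect_creation_mul_annihilation_eq_zero (ω₀ : InfVolFermionState d) (h : ω₀.IsEven)
    {Λ : Finset (Site (d + 1))} {x x' : Site (d + 1)} (hx : x ∈ Λ) (hx' : x' ∈ Λ) (hxx' : x 0 ≠ x' 0) (σ τ : Fin 2) :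
    (ω₀.stack h).expect Λ ((cAt x hx σ)ᴴ * cAt x' hx' τ) = 0 := by
  rw [cAt_eq_fermionEmbed_tileEmb_layer x hx σ, cAt_eq_fermionEmbed_tileEmb_layer x' hx' τ, ← fermionEmbed_conjTranspose,
    stack, productState_expect_fermionEmbed_mul_fermionEmbed_of_odd (layerTiling d) _ _ Λ hxx']
  rw [cAt, annihilation_conjTranspose, parityAut_creation]

/-- **Interlayer bond energies of the stack vanish**: `K_w(⊗ ω₀) = 0` whenever `w₀ ≠ 0`.
[cite: ArakiMoriya2003, §11.1 Theorem 11.2] -/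
theorem meanEnergy_stack_vectorHopping_eq_zero (ω₀ : InfVolFermionState d) (h : ω₀.IsEven) {w : Site (d + 1)}
    (hw : w 0 ≠ 0) (t : ℝ) {R : ℝ} (hwR : w ∈ thicken ({0} : Finset (Site (d + 1))) R) :
    (ω₀.stack h).meanEnergy (vectorHoppingFermionInteraction (d + 1) w t) R = 0 := by
  have hw0 : w ≠ 0 := fun h0 => hw (by rw [h0]; rfl)
  have hpair : ∀ (x : Site (d + 1)),
      (ω₀.stack h).expect {x, x + w} ((vectorHoppingFermionInteraction (d + 1) w t).Φ {x, x + w}) = 0 := by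
    intro x
    rw [vectorHoppingFermionInteraction_apply_pair hw0, map_smul, map_sum]
    refine smul_eq_zero_of_right _ (Finset.sum_eq_zero fun σ _ => ?_)
    rw [map_add, stack_expect_creation_mul_annihilation_eq_zero ω₀ h _ _ (apply_zero_ne_of_add hw),
      stack_expect_creation_mul_annihilation_eq_zero ω₀ h _ _ (apply_zero_ne_of_add hw).symm, add_zero]
  rw [InfVolFermionState.meanEnergy, vectorHoppingFermionInteraction_meanEnergyObs hw0 t hwR, map_add, map_smul,
    map_smul, (ω₀.stack h).compatible, (ω₀.stack h).compatible, hpair]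
  have h2 := hpair (-w)
  rw [show -w + w = (0 : Site (d + 1)) from neg_add_cancel w] at h2 ⊢
  · rw [h2, smul_zero, add_zero, Complex.zero_re]

/-- **MEAN ENERGY OF THE STACK = MEAN ENERGY OF `ω₀`**: for a translation-invariant `ω₀` on `ℤ^d`, the
stacked state evaluates the layered model exactly as `ω₀` evaluates the one-band model — the interlayer
couplings contribute nothing. (Range parameters: `R ≥ 1` containing the `u_a`, `R' ≥ R` containing the `w_b`.)
[cite: ArakiMoriya2003, §11.1 Theorem 11.2] -/
theorem meanEnergy_stack_layeredModel {ι κ : Type*} [Fintype ι] [Fintype κ] {ω₀ : InfVolFermionState d}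
    (hω₀ : ω₀.IsTranslationInvariant) (h : ω₀.IsEven) (U : ℝ) {u : ι → Site d} (hu : ∀ a, u a ≠ 0) (θ : ι → ℝ)
    {w : κ → Site (d + 1)} (hw : ∀ b, w b 0 ≠ 0) (tz : κ → ℝ) {R R' : ℝ} (hR : 1 ≤ R) (hRR' : R ≤ R')
    (huR : ∀ a, u a ∈ thicken ({0} : Finset (Site d)) R) (hwR' : ∀ b, w b ∈ thicken ({0} : Finset (Site (d + 1))) R') :
    (ω₀.stack h).meanEnergy (layeredModel U u θ w tz) R' = ω₀.meanEnergy (vectorHoppingModel U u θ) R := by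
  rw [meanEnergy_layeredModel, meanEnergy_vectorHoppingModel, meanEnergy_stack_onSite hω₀ h U hR (hR.trans hRR')]
  have hin : ∀ a, (ω₀.stack h).meanEnergy (vectorHoppingFermionInteraction (d + 1) (layerHom d (u a)) 1) R' =
      ω₀.meanEnergy (vectorHoppingFermionInteraction d (u a) 1) R := fun a =>
    meanEnergy_stack_vectorHopping_layerHom ω₀ h (hu a) 1 (huR a) (thicken_mono _ hRR' (layerHom_mem_thicken (huR a)))
  have hout : ∀ b, (ω₀.stack h).meanEnergy (vectorHoppingFermionInteraction (d + 1) (w b) 1) R' = 0 := fun b =>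
    meanEnergy_stack_vectorHopping_eq_zero ω₀ h (hw b) 1 (hwR' b)
  simp only [hin, hout, mul_zero, Finset.sum_const_zero, add_zero]

end InfVolFermionState

/-! ### §5. Dimension-raising transport of the fixed-filling ground-state energy density -/

section Transport

variable {d : ℕ} {ι κ : Type*} [Fintype ι] [Fintype κ]

/-- **PULLBACK FLOOR for every translation-invariant state of the layered crystal**: its mean energy is
the one-band mean energy of its layer marginal (a translation-invariant state of `ℤ^d` with the same
density) plus the interlayer bond energies, each `≥ −2|tz_b|`. [cite: BratteliRobinsonI1987, §4.3.1] -/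
theorem InfVolFermionState.IsTranslationInvariant.meanEnergy_layeredModel_eq_mapAct_add {ω : InfVolFermionState (d + 1)}
    (hω : ω.IsTranslationInvariant) (U : ℝ) {u : ι → Site d} (hu : ∀ a, u a ≠ 0) (θ : ι → ℝ)
    (w : κ → Site (d + 1)) (tz : κ → ℝ) {R R' : ℝ} (hR : 1 ≤ R) (hRR' : R ≤ R')
    (huR : ∀ a, u a ∈ thicken ({0} : Finset (Site d)) R) :
    ω.meanEnergy (layeredModel U u θ w tz) R' =
      (ω.mapAct (layerHom d) (layerHom_injective d)).meanEnergy (vectorHoppingModel U u θ) R +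
        ∑ b, tz b * ω.meanEnergy (vectorHoppingFermionInteraction (d + 1) (w b) 1) R' := by
  rw [InfVolFermionState.meanEnergy_layeredModel, InfVolFermionState.meanEnergy_vectorHoppingModel,
    hω.meanEnergy_onSite_mapAct (layerHom d) (layerHom_injective d) U hR (hR.trans hRR')]
  congr 2
  refine Finset.sum_congr rfl fun a _ => ?_
  rw [ω.meanEnergy_vectorHopping_mapAct (layerHom d) (layerHom_injective d) (hu a) 1 (huR a)
    (thicken_mono _ hRR' (layerHom_mem_thicken (huR a)))]

/-- **FLOOR**: every translation-invariant state of the layered crystal with density `ρ` has mean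
energy `≥ e_ρ(one-band model on ℤ^d) − 2 Σ_b |tz_b|`. [cite: BratteliKishimotoRobinson1978, Thm. 2 (condition 2)] -/
theorem InfVolFermionState.IsTranslationInvariant.tiGroundEnergyDensityAt_sub_le_meanEnergy_layeredModel
    {ω : InfVolFermionState (d + 1)}
    (hω : ω.IsTranslationInvariant) {ρ : ℝ} (hρ : ω.density = ρ) (U : ℝ) {u : ι → Site d} (hu : ∀ a, u a ≠ 0)
    (θ : ι → ℝ) {w : κ → Site (d + 1)} (hw : ∀ b, w b ≠ 0) (tz : κ → ℝ) {R R' : ℝ} (hR : 1 ≤ R) (hRR' : R ≤ R')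
    (huR : ∀ a, u a ∈ thicken ({0} : Finset (Site d)) R) (hwR' : ∀ b, w b ∈ thicken ({0} : Finset (Site (d + 1))) R') :
    (vectorHoppingModel U u θ).tiGroundEnergyDensityAt R ρ - 2 * ∑ b, |tz b| ≤
      ω.meanEnergy (layeredModel U u θ w tz) R' := by
  rw [hω.meanEnergy_layeredModel_eq_mapAct_add U hu θ w tz hR hRR' huR, Finset.mul_sum]
  have hTI : (ω.mapAct (layerHom d) (layerHom_injective d)).IsTranslationInvariant := hω.mapAct (layerHom d) (layerHom_injective d)
  have hρ' : (ω.mapAct (layerHom d) (layerHom_injective d)).density = ρ := by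
    rw [InfVolFermionState.density_mapAct _ _ _ (map_zero _), hρ]
  have h1 := (vectorHoppingModel U u θ).tiGroundEnergyDensityAt_le_meanEnergy R hTI hρ'
  have h2 : ∀ b, -(2 * |tz b|) ≤ tz b * ω.meanEnergy (vectorHoppingFermionInteraction (d + 1) (w b) 1) R' := by
    intro b
    have hK := abs_meanEnergy_vectorHopping_le (hw b) 1 ω (hwR' b)
    rw [abs_one, mul_one] at hK
    have : |tz b * ω.meanEnergy (vectorHoppingFermionInteraction (d + 1) (w b) 1) R'| ≤ 2 * |tz b| := by
      rw [abs_mul, mul_comm 2]; exact mul_le_mul_of_nonneg_left hK (abs_nonneg _)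
    exact (abs_le.1 this).1
  have h3 : -(∑ b, 2 * |tz b|) ≤ ∑ b, tz b * ω.meanEnergy (vectorHoppingFermionInteraction (d + 1) (w b) 1) R' := by
    rw [← Finset.sum_neg_distrib]; exact Finset.sum_le_sum fun b _ => h2 b
  linarith

/-- **CAP (dimension raising)**: the fixed-filling ground-state energy density of the layered crystal is
at most that of the one-band model on `ℤ^d` — every translation-invariant state of `ℤ^d` stacks into a
translation-invariant state of `ℤ^{d+1}` of the same density and the same mean energy (`0 < d`, so that
translation-invariant states are even; the filling must be realised on `ℤ^d`).
[cite: ArakiMoriya2003, §11.1 Theorem 11.2] -/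
theorem tiGroundEnergyDensityAt_layeredModel_le (hd : 0 < d) {ρ : ℝ}
    (hne : ∃ ω₀ : InfVolFermionState d, ω₀.IsTranslationInvariant ∧ ω₀.density = ρ)
    (U : ℝ) {u : ι → Site d} (hu : ∀ a, u a ≠ 0) (θ : ι → ℝ) {w : κ → Site (d + 1)} (hw : ∀ b, w b 0 ≠ 0)
    (tz : κ → ℝ) {R R' : ℝ} (hR : 1 ≤ R) (hRR' : R ≤ R') (huR : ∀ a, u a ∈ thicken ({0} : Finset (Site d)) R)
    (hwR' : ∀ b, w b ∈ thicken ({0} : Finset (Site (d + 1))) R') :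
    (layeredModel U u θ w tz).tiGroundEnergyDensityAt R' ρ ≤ (vectorHoppingModel U u θ).tiGroundEnergyDensityAt R ρ := by
  refine (vectorHoppingModel U u θ).le_tiGroundEnergyDensityAt R hne fun ω₀ hω₀ hρ₀ => ?_
  have he := hω₀.isEven hd
  rw [← InfVolFermionState.meanEnergy_stack_layeredModel hω₀ he U hu θ hw tz hR hRR' huR hwR']
  exact (layeredModel U u θ w tz).tiGroundEnergyDensityAt_le_meanEnergy R'
    (InfVolFermionState.stack_isTranslationInvariant hω₀ he) (by rw [InfVolFermionState.density_stack, hρ₀])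

/-- **FLOOR (dimension raising)**: the fixed-filling ground-state energy density of the layered crystal is
at least that of the one-band model on `ℤ^d` minus `2 Σ_b |tz_b|` (layer marginal + norm row
`|K_w| ≤ 2`). [cite: BratteliKishimotoRobinson1978, Thm. 2 (condition 2)] -/
theorem tiGroundEnergyDensityAt_sub_le_layeredModel (hd : 0 < d) {ρ : ℝ}
    (hne : ∃ ω₀ : InfVolFermionState d, ω₀.IsTranslationInvariant ∧ ω₀.density = ρ)
    (U : ℝ) {u : ι → Site d} (hu : ∀ a, u a ≠ 0) (θ : ι → ℝ) {w : κ → Site (d + 1)} (hw : ∀ b, w b 0 ≠ 0)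
    (tz : κ → ℝ) {R R' : ℝ} (hR : 1 ≤ R) (hRR' : R ≤ R') (huR : ∀ a, u a ∈ thicken ({0} : Finset (Site d)) R)
    (hwR' : ∀ b, w b ∈ thicken ({0} : Finset (Site (d + 1))) R') :
    (vectorHoppingModel U u θ).tiGroundEnergyDensityAt R ρ - 2 * ∑ b, |tz b| ≤
      (layeredModel U u θ w tz).tiGroundEnergyDensityAt R' ρ := by
  obtain ⟨ω₀, hω₀, hρ₀⟩ := hne
  have he := hω₀.isEven hd
  have hne' : ∃ ω : InfVolFermionState (d + 1), ω.IsTranslationInvariant ∧ ω.density = ρ :=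
    ⟨ω₀.stack he, InfVolFermionState.stack_isTranslationInvariant hω₀ he, by rw [InfVolFermionState.density_stack, hρ₀]⟩
  have hw0 : ∀ b, w b ≠ 0 := fun b h0 => hw b (by rw [h0]; rfl)
  exact (layeredModel U u θ w tz).le_tiGroundEnergyDensityAt R' hne' fun ω hω hρ =>
    hω.tiGroundEnergyDensityAt_sub_le_meanEnergy_layeredModel hρ U hu θ hw0 tz hR hRR' huR hwR'

/-- **THE DIMENSION-RAISING WINDOW**: `e_ρ(layered crystal) ∈ [e_ρ(one-band, ℤ^d) − 2Σ|tz_b|, e_ρ(one-band, ℤ^d)]`.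
[cite: ArakiMoriya2003, §11.1 Theorem 11.2] -/
theorem tiGroundEnergyDensityAt_layeredModel_mem_Icc (hd : 0 < d) {ρ : ℝ}
    (hne : ∃ ω₀ : InfVolFermionState d, ω₀.IsTranslationInvariant ∧ ω₀.density = ρ)
    (U : ℝ) {u : ι → Site d} (hu : ∀ a, u a ≠ 0) (θ : ι → ℝ) {w : κ → Site (d + 1)} (hw : ∀ b, w b 0 ≠ 0)
    (tz : κ → ℝ) {R R' : ℝ} (hR : 1 ≤ R) (hRR' : R ≤ R') (huR : ∀ a, u a ∈ thicken ({0} : Finset (Site d)) R)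
    (hwR' : ∀ b, w b ∈ thicken ({0} : Finset (Site (d + 1))) R') :
    (layeredModel U u θ w tz).tiGroundEnergyDensityAt R' ρ ∈
      Set.Icc ((vectorHoppingModel U u θ).tiGroundEnergyDensityAt R ρ - 2 * ∑ b, |tz b|)
        ((vectorHoppingModel U u θ).tiGroundEnergyDensityAt R ρ) :=
  ⟨tiGroundEnergyDensityAt_sub_le_layeredModel hd hne U hu θ hw tz hR hRR' huR hwR',
    tiGroundEnergyDensityAt_layeredModel_le hd hne U hu θ hw tz hR hRR' huR hwR'⟩

/-- **Every certified one-band window is a layered-crystal window**: `lo ≤ e_ρ(one-band) ≤ hi` implies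
`lo − 2Σ|tz_b| ≤ e_ρ(layered) ≤ hi`. [cite: ArakiMoriya2003, §11.1 Theorem 11.2] -/
theorem tiGroundEnergyDensityAt_layeredModel_mem_Icc_of_window (hd : 0 < d) {ρ : ℝ}
    (hne : ∃ ω₀ : InfVolFermionState d, ω₀.IsTranslationInvariant ∧ ω₀.density = ρ)
    (U : ℝ) {u : ι → Site d} (hu : ∀ a, u a ≠ 0) (θ : ι → ℝ) {w : κ → Site (d + 1)} (hw : ∀ b, w b 0 ≠ 0)
    (tz : κ → ℝ) {R R' : ℝ} (hR : 1 ≤ R) (hRR' : R ≤ R') (huR : ∀ a, u a ∈ thicken ({0} : Finset (Site d)) R)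
    (hwR' : ∀ b, w b ∈ thicken ({0} : Finset (Site (d + 1))) R') {lo hi : ℝ}
    (hlo : lo ≤ (vectorHoppingModel U u θ).tiGroundEnergyDensityAt R ρ)
    (hhi : (vectorHoppingModel U u θ).tiGroundEnergyDensityAt R ρ ≤ hi) :
    (layeredModel U u θ w tz).tiGroundEnergyDensityAt R' ρ ∈ Set.Icc (lo - 2 * ∑ b, |tz b|) hi := by
  have h := tiGroundEnergyDensityAt_layeredModel_mem_Icc hd hne U hu θ hw tz hR hRR' huR hwR'
  exact ⟨by linarith [h.1], h.2.trans hhi⟩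

end Transport

/-! ### §6. The `t–t'` Hubbard layer: certified 2D rows are 3D layered-crystal words -/

section TTPrime

variable {κ : Type*} [Fintype κ]

/-- The four bond vectors of the `t–t'` model: `e₁, e₂, e₁ + e₂, e₁ − e₂`. [cite: XuEtAl2024, eq. (1)] -/
def ttPrimeVec : Fin 4 → Site 2 := ![unitVec 0, unitVec 1, diagVec 0, diagVec 1]

/-- Their amplitudes `(t, t, t', t')`. [cite: XuEtAl2024, eq. (1)] -/
def ttPrimeAmp (t t' : ℝ) : Fin 4 → ℝ := ![t, t, t', t']

/-- The `t–t'` bond vectors are nonzero. [cite: XuEtAl2024, eq. (1)] -/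
theorem ttPrimeVec_ne_zero (a : Fin 4) : ttPrimeVec a ≠ 0 := by
  have hu : ∀ i : Fin 2, (unitVec i : Site 2) ≠ 0 := fun i h => by
    have := congrFun h i
    simp [unitVec] at this
  fin_cases a
  · exact hu 0
  · exact hu 1
  · exact diagVec_ne_zero 0
  · exact diagVec_ne_zero 1

/-- The `t–t'` bond vectors lie in the unit range box. [cite: XuEtAl2024, eq. (1)] -/
theorem ttPrimeVec_mem_thicken_one (a : Fin 4) : ttPrimeVec a ∈ thicken ({0} : Finset (Site 2)) 1 := by
  fin_cases a
  · exact unitVec_mem_thicken_one 0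
  · exact unitVec_mem_thicken_one 1
  · exact diagVec_mem_thicken_one 0
  · exact diagVec_mem_thicken_one 1

/-- **The `t–t'` Hubbard interaction is the one-band model with bond vectors `e₁, e₂, e₁ ± e₂` and
amplitudes `(t, t, t', t')`** (dictionary with `vectorHoppingModel`). [cite: XuEtAl2024, eq. (1)] -/
theorem hubbardTTPrimeFermionInteraction_eq_vectorHoppingModel (t t' U : ℝ) :
    hubbardTTPrimeFermionInteraction t t' U = vectorHoppingModel U ttPrimeVec (ttPrimeAmp t t') := by
  refine FermionInteraction.ext fun X => ?_
  rw [hubbardTTPrimeFermionInteraction_apply, hubbardFermionInteraction_apply_eq_onSite_add_sum_vectorHopping,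
    diagHoppingFermionInteraction_apply_eq_sum_vectorHopping, vectorHoppingModel, FermionInteraction.linearFamily_apply,
    Fin.sum_univ_four, Fin.sum_univ_two, Fin.sum_univ_two, add_assoc]
  have hs : ∀ (v : Site 2) (c : ℝ), (vectorHoppingFermionInteraction 2 v c).Φ X =
      ((c : ℝ) : ℂ) • (vectorHoppingFermionInteraction 2 v 1).Φ X := fun v c => by
    rw [← vectorHoppingFermionInteraction_smul_apply, mul_one]
  simp only [ttPrimeVec, ttPrimeAmp, Matrix.cons_val_zero, Matrix.cons_val_one, Matrix.cons_val,
    hs (unitVec 0) t, hs (unitVec 1) t, hs (diagVec 0) t', hs (diagVec 1) t', add_assoc]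

/-- **The layered `t–t'` Hubbard crystal on `ℤ³`**: in every layer the `t–t'–U` model, plus interlayer
hoppings `tz_b` along vectors `w_b` (`(w_b)₀ ≠ 0`). [cite: PavariniEtAl2001, eq. (1)] -/
def layeredHubbardTTPrime (t t' U : ℝ) (w : κ → Site 3) (tz : κ → ℝ) : FermionInteraction 3 :=
  layeredModel U ttPrimeVec (ttPrimeAmp t t') w tz

/-- **2D ROWS ⇒ 3D WORDS.** For `U ≥ 0`, `0 < ρ < 2` and interlayer vectors `w_b` with `(w_b)₀ ≠ 0` inside
the range box `R' ≥ 1`: the fixed-filling ground-state energy density of the layered `t–t'` Hubbard crystal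
lies in `[energyDensityTT' t t' U ρ − 2Σ_b |tz_b|, energyDensityTT' t t' U ρ]`.
[cite: ArakiMoriya2003, §11.1 Theorem 11.2] -/
theorem tiGroundEnergyDensityAt_layeredHubbardTTPrime_mem_Icc (t t' : ℝ) {U : ℝ} (hU : 0 ≤ U) {ρ : ℝ}
    (hρ0 : 0 < ρ) (hρ2 : ρ < 2) {w : κ → Site 3} (hw : ∀ b, w b 0 ≠ 0) (tz : κ → ℝ) {R' : ℝ} (hR' : 1 ≤ R')
    (hwR' : ∀ b, w b ∈ thicken ({0} : Finset (Site 3)) R') :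
    (layeredHubbardTTPrime t t' U w tz).tiGroundEnergyDensityAt R' ρ ∈
      Set.Icc (energyDensityTT' t t' U ρ - 2 * ∑ b, |tz b|) (energyDensityTT' t t' U ρ) := by
  rw [← tiGroundEnergyDensityAt_hubbardTTPrime_eq_energyDensityTT' t t' hU hρ0 hρ2,
    hubbardTTPrimeFermionInteraction_eq_vectorHoppingModel]
  exact tiGroundEnergyDensityAt_layeredModel_mem_Icc two_pos (exists_isTranslationInvariant_density_eq hρ0 hρ2) U
    ttPrimeVec_ne_zero (ttPrimeAmp t t') hw tz le_rfl hR' ttPrimeVec_mem_thicken_one hwR'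

/-- **Window form**: a certified 2D window `lo ≤ energyDensityTT' t t' U ρ ≤ hi` gives the 3D layered-crystal
window `[lo − 2Σ_b |tz_b|, hi]` (caps transfer verbatim; floors lose `2Σ|tz|`).
[cite: ArakiMoriya2003, §11.1 Theorem 11.2] -/
theorem tiGroundEnergyDensityAt_layeredHubbardTTPrime_mem_Icc_of_window (t t' : ℝ) {U : ℝ} (hU : 0 ≤ U) {ρ : ℝ}
    (hρ0 : 0 < ρ) (hρ2 : ρ < 2) {w : κ → Site 3} (hw : ∀ b, w b 0 ≠ 0) (tz : κ → ℝ) {R' : ℝ} (hR' : 1 ≤ R')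
    (hwR' : ∀ b, w b ∈ thicken ({0} : Finset (Site 3)) R') {lo hi : ℝ} (hlo : lo ≤ energyDensityTT' t t' U ρ)
    (hhi : energyDensityTT' t t' U ρ ≤ hi) :
    (layeredHubbardTTPrime t t' U w tz).tiGroundEnergyDensityAt R' ρ ∈ Set.Icc (lo - 2 * ∑ b, |tz b|) hi := by
  have h := tiGroundEnergyDensityAt_layeredHubbardTTPrime_mem_Icc t t' hU hρ0 hρ2 hw tz hR' hwR'
  exact ⟨by linarith [h.1], h.2.trans hhi⟩

/-- The vertical interlayer vector `e₀ = (1, 0, 0)` of `ℤ³`. [cite: PavariniEtAl2001, eq. (1)] -/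
theorem unitVec_zero_apply_zero_ne_zero : (unitVec (0 : Fin 3) : Site 3) 0 ≠ 0 := by simp [unitVec]

/-- **Simple tetragonal stacking** (one vertical hopping `t_z` along `(1, 0, 0)`): the layered `t–t'` Hubbard
crystal has fixed-filling ground-state energy density in
`[energyDensityTT' t t' U ρ − 2|t_z|, energyDensityTT' t t' U ρ]`. [cite: ArakiMoriya2003, §11.1 Theorem 11.2] -/
theorem tiGroundEnergyDensityAt_verticalHubbardTTPrime_mem_Icc (t t' : ℝ) {U : ℝ} (hU : 0 ≤ U) {ρ : ℝ}
    (hρ0 : 0 < ρ) (hρ2 : ρ < 2) (tz : ℝ) :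
    (layeredHubbardTTPrime t t' U (fun _ : Fin 1 => (unitVec (0 : Fin 3) : Site 3)) fun _ => tz).tiGroundEnergyDensityAt 1 ρ ∈
      Set.Icc (energyDensityTT' t t' U ρ - 2 * |tz|) (energyDensityTT' t t' U ρ) := by
  have h := tiGroundEnergyDensityAt_layeredHubbardTTPrime_mem_Icc t t' hU hρ0 hρ2
    (w := fun _ : Fin 1 => (unitVec (0 : Fin 3) : Site 3)) (fun _ => unitVec_zero_apply_zero_ne_zero) (fun _ => tz) le_rfl
    (fun _ => unitVec_mem_thicken_one 0)
  simpa using h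

end TTPrime

/-! ### §7. The nearest-neighbour Hubbard model in any dimension: `ℤ^d` rows are `ℤ^{d+1}` layered words -/

section NearestNeighbour

variable {d : ℕ} {κ : Type*} [Fintype κ]

/-- **The nearest-neighbour Hubbard interaction is the one-band model with the `d` unit bond vectors and
equal amplitudes `t`** (the tree's `hubbardFermionInteraction_eq_linearFamily_vectorHopping`).
[cite: KomaTasaki1994, §1] -/
theorem hubbardFermionInteraction_eq_vectorHoppingModel (t U : ℝ) :
    hubbardFermionInteraction d t U = vectorHoppingModel U (fun i : Fin d => (unitVec i : Site d)) fun _ => t :=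
  hubbardFermionInteraction_eq_linearFamily_vectorHopping t U

/-- The unit vectors of `ℤ^d` are nonzero. [folklore] -/
private theorem unitVec_ne_zero' (i : Fin d) : (unitVec i : Site d) ≠ 0 := fun h => by
  have := congrFun h i
  simp [unitVec] at this

/-- **`ℤ^d` ROWS ⇒ `ℤ^{d+1}` WORDS for the nearest-neighbour Hubbard model** (`0 < d`, filling `ρ` realised
on `ℤ^d`): the layered crystal built from `Φ^{t,U}` on `ℤ^d` with interlayer hoppings `tz_b` along `w_b`
(`(w_b)₀ ≠ 0`, inside the range box `R' ≥ 1`) has fixed-filling ground-state energy density in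
`[e_ρ(Φ^{t,U}; ℤ^d) − 2Σ_b|tz_b|, e_ρ(Φ^{t,U}; ℤ^d)]` — chains ⇒ coupled-chain arrays (`d = 1`), square
lattice ⇒ layered cubic crystals (`d = 2`), … [cite: ArakiMoriya2003, §11.1 Theorem 11.2] -/
theorem tiGroundEnergyDensityAt_layeredHubbard_mem_Icc (hd : 0 < d) {ρ : ℝ}
    (hne : ∃ ω₀ : InfVolFermionState d, ω₀.IsTranslationInvariant ∧ ω₀.density = ρ) (t U : ℝ)
    {w : κ → Site (d + 1)} (hw : ∀ b, w b 0 ≠ 0) (tz : κ → ℝ) {R' : ℝ} (hR' : 1 ≤ R')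
    (hwR' : ∀ b, w b ∈ thicken ({0} : Finset (Site (d + 1))) R') :
    (layeredModel U (fun i : Fin d => (unitVec i : Site d)) (fun _ => t) w tz).tiGroundEnergyDensityAt R' ρ ∈
      Set.Icc ((hubbardFermionInteraction d t U).tiGroundEnergyDensityAt 1 ρ - 2 * ∑ b, |tz b|)
        ((hubbardFermionInteraction d t U).tiGroundEnergyDensityAt 1 ρ) := by
  rw [hubbardFermionInteraction_eq_vectorHoppingModel]
  exact tiGroundEnergyDensityAt_layeredModel_mem_Icc hd hne U unitVec_ne_zero' (fun _ => t) hw tz le_rfl hR'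
    unitVec_mem_thicken_one hwR'

end NearestNeighbour

/-! ### §8. Energy-window words transfer to the layer marginals of near-ground states of the crystal -/

section WordTransfer

variable {d : ℕ} {ι κ : Type*} [Fintype ι] [Fintype κ]

/-- **The layer marginal of a near-ground state of the crystal is a near-ground state of the one-band model**:
if a translation-invariant `ω` of `ℤ^{d+1}` has layered-model energy within `ε` of the fixed-filling infimum at
`ρ`, its layer marginal `ω ∘ Γ_{layer}` (translation invariant, same density as `ω`) has one-band energy within
`ε + 2Σ_b|tz_b|` of `e_ρ(one-band, ℤ^d)` (pullback decomposition + cap). [cite: ArakiMoriya2003, §11.1 Theorem 11.2] -/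
theorem InfVolFermionState.IsTranslationInvariant.meanEnergy_mapAct_layerHom_le_of_le (hd : 0 < d)
    {ω : InfVolFermionState (d + 1)} (hω : ω.IsTranslationInvariant) {ρ : ℝ}
    (hne : ∃ ω₀ : InfVolFermionState d, ω₀.IsTranslationInvariant ∧ ω₀.density = ρ)
    (U : ℝ) {u : ι → Site d} (hu : ∀ a, u a ≠ 0) (θ : ι → ℝ) {w : κ → Site (d + 1)} (hw : ∀ b, w b 0 ≠ 0)
    (tz : κ → ℝ) {R R' : ℝ} (hR : 1 ≤ R) (hRR' : R ≤ R') (huR : ∀ a, u a ∈ thicken ({0} : Finset (Site d)) R)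
    (hwR' : ∀ b, w b ∈ thicken ({0} : Finset (Site (d + 1))) R') {ε : ℝ}
    (hε : ω.meanEnergy (layeredModel U u θ w tz) R' ≤ (layeredModel U u θ w tz).tiGroundEnergyDensityAt R' ρ + ε) :
    (ω.mapAct (layerHom d) (layerHom_injective d)).meanEnergy (vectorHoppingModel U u θ) R ≤
      (vectorHoppingModel U u θ).tiGroundEnergyDensityAt R ρ + (ε + 2 * ∑ b, |tz b|) := by
  have hdec := hω.meanEnergy_layeredModel_eq_mapAct_add U hu θ w tz hR hRR' huR
  have hcap := tiGroundEnergyDensityAt_layeredModel_le hd hne U hu θ hw tz hR hRR' huR hwR'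
  have hw0 : ∀ b, w b ≠ 0 := fun b h0 => hw b (by rw [h0]; rfl)
  have h2 : ∀ b, -(2 * |tz b|) ≤ tz b * ω.meanEnergy (vectorHoppingFermionInteraction (d + 1) (w b) 1) R' := by
    intro b
    have hK := abs_meanEnergy_vectorHopping_le (hw0 b) 1 ω (hwR' b)
    rw [abs_one, mul_one] at hK
    have : |tz b * ω.meanEnergy (vectorHoppingFermionInteraction (d + 1) (w b) 1) R'| ≤ 2 * |tz b| := by
      rw [abs_mul, mul_comm 2]; exact mul_le_mul_of_nonneg_left hK (abs_nonneg _)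
    exact (abs_le.1 this).1
  have h3 : -(∑ b, 2 * |tz b|) ≤ ∑ b, tz b * ω.meanEnergy (vectorHoppingFermionInteraction (d + 1) (w b) 1) R' := by
    rw [← Finset.sum_neg_distrib]; exact Finset.sum_le_sum fun b _ => h2 b
  rw [Finset.mul_sum]
  linarith

/-- **ENERGY-WINDOW WORDS TRANSFER TO THE CRYSTAL** (the «order-word» leg of the interlayer coupling): a word
`P` certified for every translation-invariant `σ` of `ℤ^d` of density `ρ` whose one-band energy is within
`ε + 2Σ_b|tz_b|` of `e_ρ` holds for the LAYER MARGINAL of every translation-invariant state of the crystal of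
density `ρ` whose layered-model energy is within `ε` of its infimum — e.g. the pair-amplitude ceilings /
ABSENT words of the S2 → S3 seam apply to the in-plane state of the three-dimensional crystal's near-ground states
after booking `2Σ|tz|` of energy slack. [cite: ArakiMoriya2003, §11.1 Theorem 11.2] -/
theorem layeredModel_energyWindow_word_mapAct_layerHom (hd : 0 < d) {ρ : ℝ}
    (hne : ∃ ω₀ : InfVolFermionState d, ω₀.IsTranslationInvariant ∧ ω₀.density = ρ)
    (U : ℝ) {u : ι → Site d} (hu : ∀ a, u a ≠ 0) (θ : ι → ℝ) {w : κ → Site (d + 1)} (hw : ∀ b, w b 0 ≠ 0)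
    (tz : κ → ℝ) {R R' : ℝ} (hR : 1 ≤ R) (hRR' : R ≤ R') (huR : ∀ a, u a ∈ thicken ({0} : Finset (Site d)) R)
    (hwR' : ∀ b, w b ∈ thicken ({0} : Finset (Site (d + 1))) R') {P : InfVolFermionState d → Prop} {ε : ℝ}
    (hword : ∀ σ : InfVolFermionState d, σ.IsTranslationInvariant → σ.density = ρ →
      σ.meanEnergy (vectorHoppingModel U u θ) R ≤ (vectorHoppingModel U u θ).tiGroundEnergyDensityAt R ρ + (ε + 2 * ∑ b, |tz b|) →
        P σ)
    {ω : InfVolFermionState (d + 1)} (hω : ω.IsTranslationInvariant) (hρ : ω.density = ρ)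
    (hε : ω.meanEnergy (layeredModel U u θ w tz) R' ≤ (layeredModel U u θ w tz).tiGroundEnergyDensityAt R' ρ + ε) :
    P (ω.mapAct (layerHom d) (layerHom_injective d)) :=
  hword _ (hω.mapAct (layerHom d) (layerHom_injective d))
    (by rw [InfVolFermionState.density_mapAct _ _ _ (map_zero _), hρ])
    (hω.meanEnergy_mapAct_layerHom_le_of_le hd hne U hu θ hw tz hR hRR' huR hwR' hε)

/-- **`t–t'` instance**: a word certified for the 2D near-minimisers of `Φ(t,t',U)` at filling `ρ` with energy
slack `ε + 2Σ_b|tz_b|` above `energyDensityTT' t t' U ρ` holds for the layer marginal of every translation-invariant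
state of the layered `t–t'` crystal of density `ρ` within `ε` of its fixed-filling ground-state energy density
(`U ≥ 0`, `0 < ρ < 2`). [cite: ArakiMoriya2003, §11.1 Theorem 11.2] -/
theorem layeredHubbardTTPrime_energyWindow_word_mapAct_layerHom (t t' : ℝ) {U : ℝ} (hU : 0 ≤ U) {ρ : ℝ}
    (hρ0 : 0 < ρ) (hρ2 : ρ < 2) {w : κ → Site 3} (hw : ∀ b, w b 0 ≠ 0) (tz : κ → ℝ) {R' : ℝ} (hR' : 1 ≤ R')
    (hwR' : ∀ b, w b ∈ thicken ({0} : Finset (Site 3)) R') {P : InfVolFermionState 2 → Prop} {ε : ℝ}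
    (hword : ∀ σ : InfVolFermionState 2, σ.IsTranslationInvariant → σ.density = ρ →
      σ.meanEnergy (hubbardTTPrimeFermionInteraction t t' U) 1 ≤ energyDensityTT' t t' U ρ + (ε + 2 * ∑ b, |tz b|) → P σ)
    {ω : InfVolFermionState 3} (hω : ω.IsTranslationInvariant) (hρ : ω.density = ρ)
    (hε : ω.meanEnergy (layeredHubbardTTPrime t t' U w tz) R' ≤
      (layeredHubbardTTPrime t t' U w tz).tiGroundEnergyDensityAt R' ρ + ε) :
    P (ω.mapAct (layerHom 2) (layerHom_injective 2)) := by
  refine layeredModel_energyWindow_word_mapAct_layerHom two_pos (exists_isTranslationInvariant_density_eq hρ0 hρ2) U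
    ttPrimeVec_ne_zero (ttPrimeAmp t t') hw tz le_rfl hR' ttPrimeVec_mem_thicken_one hwR' (fun σ hσ hσρ hσe => ?_) hω hρ hε
  refine hword σ hσ hσρ ?_
  rwa [← hubbardTTPrimeFermionInteraction_eq_vectorHoppingModel,
    tiGroundEnergyDensityAt_hubbardTTPrime_eq_energyDensityTT' t t' hU hρ0 hρ2] at hσe

end WordTransfer

/-! ### §9. Box words: a certified 2D box word is a 3D layered-crystal box word (S2-seam shape) -/

section BoxWords

variable {κ : Type*} [Fintype κ]

/-- **2D BOX WORD ⇒ 3D CRYSTAL BOX WORD** (S2-seam shape `θ = (U/t, t′/t, n)`, `t ≡ 1`): if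
`lo ≤ energyDensityTT' 1 (θ 1) (θ 0) (θ 2) ≤ hi` for every `θ` of a parameter set `B` on which `U ≥ 0` and
`0 < n < 2`, then for every `θ ∈ B` and every interlayer pattern (vectors `w_b` with `(w_b)₀ ≠ 0` inside the range
box `R' ≥ 1`, amplitudes `tz_b`) the layered crystal's fixed-filling ground-state energy density lies in
`[lo − 2Σ_b|tz_b|, hi]`. [cite: ArakiMoriya2003, §11.1 Theorem 11.2] -/
theorem layeredHubbardTTPrime_boxword_of_boxword {B : Set (Fin 3 → ℝ)} {lo hi : ℝ}
    (hB : ∀ θ ∈ B, 0 ≤ θ 0 ∧ 0 < θ 2 ∧ θ 2 < 2)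
    (hword : ∀ θ ∈ B, lo ≤ energyDensityTT' 1 (θ 1) (θ 0) (θ 2) ∧ energyDensityTT' 1 (θ 1) (θ 0) (θ 2) ≤ hi)
    {w : κ → Site 3} (hw : ∀ b, w b 0 ≠ 0) (tz : κ → ℝ) {R' : ℝ} (hR' : 1 ≤ R')
    (hwR' : ∀ b, w b ∈ thicken ({0} : Finset (Site 3)) R') :
    ∀ θ ∈ B, lo - 2 * ∑ b, |tz b| ≤ (layeredHubbardTTPrime 1 (θ 1) (θ 0) w tz).tiGroundEnergyDensityAt R' (θ 2) ∧
      (layeredHubbardTTPrime 1 (θ 1) (θ 0) w tz).tiGroundEnergyDensityAt R' (θ 2) ≤ hi := by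
  intro θ hθ
  obtain ⟨hU, hn0, hn2⟩ := hB θ hθ
  exact tiGroundEnergyDensityAt_layeredHubbardTTPrime_mem_Icc_of_window 1 (θ 1) hU hn0 hn2 hw tz hR' hwR'
    (hword θ hθ).1 (hword θ hθ).2

/-- **… with a BOX of interlayer amplitudes**: if moreover `Σ_b |tz_b| ≤ m` (e.g. the router's `tperp/t` interval), the
window is `[lo − 2m, hi]` uniformly. [cite: ArakiMoriya2003, §11.1 Theorem 11.2] -/
theorem layeredHubbardTTPrime_boxword_of_boxword_of_sum_le {B : Set (Fin 3 → ℝ)} {lo hi : ℝ}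
    (hB : ∀ θ ∈ B, 0 ≤ θ 0 ∧ 0 < θ 2 ∧ θ 2 < 2)
    (hword : ∀ θ ∈ B, lo ≤ energyDensityTT' 1 (θ 1) (θ 0) (θ 2) ∧ energyDensityTT' 1 (θ 1) (θ 0) (θ 2) ≤ hi)
    {w : κ → Site 3} (hw : ∀ b, w b 0 ≠ 0) {R' : ℝ} (hR' : 1 ≤ R') (hwR' : ∀ b, w b ∈ thicken ({0} : Finset (Site 3)) R')
    {m : ℝ} {tz : κ → ℝ} (htz : ∑ b, |tz b| ≤ m) :
    ∀ θ ∈ B, lo - 2 * m ≤ (layeredHubbardTTPrime 1 (θ 1) (θ 0) w tz).tiGroundEnergyDensityAt R' (θ 2) ∧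
      (layeredHubbardTTPrime 1 (θ 1) (θ 0) w tz).tiGroundEnergyDensityAt R' (θ 2) ≤ hi := by
  intro θ hθ
  have h := layeredHubbardTTPrime_boxword_of_boxword hB hword hw tz hR' hwR' θ hθ
  exact ⟨by linarith [h.1], h.2⟩

/-- **Icc form**: on a coordinate box `Set.Icc lo₃ hi₃` with `lo₃ 0 ≥ 0` (so `U ≥ 0`) and `0 < lo₃ 2`, `hi₃ 2 < 2`
(fillings inside `(0,2)`), a 2D box word `[lo, hi]` is the crystal word `[lo − 2m, hi]` for every interlayer pattern with
`Σ_b |tz_b| ≤ m`. [cite: ArakiMoriya2003, §11.1 Theorem 11.2] -/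
theorem layeredHubbardTTPrime_boxword_Icc {lo₃ hi₃ : Fin 3 → ℝ} (hU : 0 ≤ lo₃ 0) (hn0 : 0 < lo₃ 2) (hn2 : hi₃ 2 < 2)
    {lo hi : ℝ}
    (hword : ∀ θ ∈ Set.Icc lo₃ hi₃, lo ≤ energyDensityTT' 1 (θ 1) (θ 0) (θ 2) ∧ energyDensityTT' 1 (θ 1) (θ 0) (θ 2) ≤ hi)
    {w : κ → Site 3} (hw : ∀ b, w b 0 ≠ 0) {R' : ℝ} (hR' : 1 ≤ R') (hwR' : ∀ b, w b ∈ thicken ({0} : Finset (Site 3)) R')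
    {m : ℝ} {tz : κ → ℝ} (htz : ∑ b, |tz b| ≤ m) :
    ∀ θ ∈ Set.Icc lo₃ hi₃, lo - 2 * m ≤ (layeredHubbardTTPrime 1 (θ 1) (θ 0) w tz).tiGroundEnergyDensityAt R' (θ 2) ∧
      (layeredHubbardTTPrime 1 (θ 1) (θ 0) w tz).tiGroundEnergyDensityAt R' (θ 2) ≤ hi :=
  layeredHubbardTTPrime_boxword_of_boxword_of_sum_le
    (fun _ hθ => ⟨hU.trans (hθ.1 0), hn0.trans_le (hθ.1 2), (hθ.2 2).trans_lt hn2⟩) hword hw hR' hwR' htz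

end BoxWords

end Literature.MathematicalPhysics.QuantumLattice
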